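import Summits.Ventures.PercRepro.GenQFlatLatticeM
import Summits.Ventures.PercRepro.GenQTraceProfileE

/-!
# PercRepro — the flat-lattice counting rows, part N: the bridges between the spanning-trace counts and the
ambient flat counts (night-4, gen 12)

The rows (G-A) ≥, (G-B), (G-C) and (T8) are stated with `hypTr M G ρ s` (the rank-`ρ` flats with a SPANNING
`s`-point trace), while the two-level profile LP uses the ambient counts `NR M G ρ s` (every rank-`ρ` flat with
`s` points of `G`); the certificate emitter bridges them with `hypTr_le_NR`.  Likewise the LP's (T0) sums the
coloop classes over `0 … q − 1` and its (T5) over the trace sizes of the hyperplane block: `spSumM_le_spSum`,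
`spSumM_eq_zero_of_flat_le`, `spSumM_eq_zero_of_lt_rank`, `spSumM_eq_zero_of_lt` and `nrInM_eq_zero_of_flat_le`
are the zero facts those sums need.  Imports `GenQFlatLatticeM`, `GenQTraceProfileE`.
-/
namespace PercRepro.Night4

open Finset ThmH SixFour GenQ PerFlat Star

variable {α : Type*} [DecidableEq α] {M : Matroid α} [M.Finite]

/-- The flats with spanning `s`-traces are among the flats with `s` points: `hypTr M G r s ≤ NR M G r s`. -/
theorem hypTr_le_NR (G : Finset α) (r s : ℕ) : hypTr M G r s ≤ NR M G r s := by
  unfold hypTr flatsTr NR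
  refine Finset.card_le_card (fun H hH => ?_)
  rw [Finset.mem_filter] at hH ⊢
  exact ⟨hH.1, hH.2.1⟩

/-- A coloop class of the spanning `j`-subsets of the `s`-traces is at most the whole: `SPm(s, j, m) ≤ SP_{s,j}`. -/
theorem spSumM_le_spSum (G : Finset α) (r s j m : ℕ) : spSumM M G r s j m ≤ spSum M G r s j := by
  unfold spSumM spSum
  exact Finset.sum_le_sum (fun H _ => spFm_le_spF G H r j m)

/-- `SPm(s, j, m) = 0` beyond the flat bound (`B < s`). -/
theorem spSumM_eq_zero_of_flat_le {G : Finset α} {r B s : ℕ} (hflat : ∀ F ∈ flatsQ M r, F.card ≤ B)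
    (hBs : B < s) (j m : ℕ) : spSumM M G r s j m = 0 :=
  Nat.eq_zero_of_le_zero ((spSumM_le_spSum G r s j m).trans (spSum_eq_zero_of_flat_le hflat hBs j).le)

/-- `SPm(s, j, m) = 0` for `s < r` (a trace of fewer than `r` points does not span a rank-`r` flat). -/
theorem spSumM_eq_zero_of_lt_rank (G : Finset α) {r s : ℕ} (hsr : s < r) (j m : ℕ) :
    spSumM M G r s j m = 0 :=
  Nat.eq_zero_of_le_zero ((spSumM_le_spSum G r s j m).trans (spSum_eq_zero_of_lt_rank G hsr j).le)

/-- `SPm(s, j, m) = 0` for `s < j` (no `j`-subset of an `s`-set). -/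
theorem spSumM_eq_zero_of_lt (G : Finset α) (r : ℕ) {s j : ℕ} (hsj : s < j) (m : ℕ) :
    spSumM M G r s j m = 0 :=
  Nat.eq_zero_of_le_zero ((spSumM_le_spSum G r s j m).trans (spSum_eq_zero_of_lt G r hsj).le)

/-- `SPm(n, j, m) = 0` when `G` itself has rank `q ≠ r` (the whole of `G` is not an `r`-trace). -/
theorem spSumM_card_eq_zero {G : Finset α} {q r : ℕ} (hrG : M.eRk (G : Set α) = (q : ℕ∞)) (hqr : q ≠ r)
    (j m : ℕ) : spSumM M G r G.card j m = 0 :=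
  Nat.eq_zero_of_le_zero ((spSumM_le_spSum G r G.card j m).trans (spSum_card_eq_zero hrG hqr j).le)

/-- No flat of rank `r` with a spanning `s′`-trace lies inside a trace once `s′` exceeds the flat bound:
`NRin(s, r, s′) = 0` for `B < s′`. -/
theorem nrInM_eq_zero_of_flat_le {G : Finset α} {r B s' : ℕ} (hflat : ∀ F ∈ flatsQ M r, F.card ≤ B)
    (hBs : B < s') (q s : ℕ) : nrInM M G q s r s' = 0 := by
  unfold nrInM
  refine Finset.sum_eq_zero (fun H _ => ?_)
  rw [flatsTr_eq_empty_of_flat_le hflat hBs]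
  rfl

/-- `NRin(s, r, s′) = 0` for `s′ < r`. -/
theorem nrInM_eq_zero_of_lt_rank (G : Finset α) {r s' : ℕ} (hsr : s' < r) (q s : ℕ) :
    nrInM M G q s r s' = 0 := by
  unfold nrInM
  refine Finset.sum_eq_zero (fun H _ => ?_)
  rw [Finset.card_eq_zero, Finset.filter_eq_empty_iff]
  intro F hF _
  have hF' := mem_flatsTr.1 hF
  have h1 : M.eRk ((F ∩ G : Finset α) : Set α) ≤ ((F ∩ G).card : ℕ∞) := by
    have := M.eRk_le_encard ((F ∩ G : Finset α) : Set α)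
    rwa [Set.encard_coe_eq_coe_finsetCard] at this
  rw [hF'.2.2, hF'.2.1] at h1
  have : r ≤ s' := by exact_mod_cast h1
  omega

/-- The ambient counts bound the flats inside the traces: `Σ_s NRin(s, r, s′) ≤ C(n − s′, q − 1 − r)·NR r s′`
((T8) in the LP's ambient form). -/
theorem sum_nrInM_le_NR {G : Finset α} (hG : G ⊆ gr M) (q r s' : ℕ) :
    ∑ s ∈ Finset.range (G.card + 1), nrInM M G q s r s' ≤ (G.card - s').choose (q - 1 - r) * NR M G r s' :=
  (sum_nrInM_le hG q r s').trans (Nat.mul_le_mul_left _ (hypTr_le_NR G r s'))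

end PercRepro.Night4
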